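import Literature.Computability.Learning.LearnerSelectFP
import Literature.Computability.Learning.LearnerRun
import Literature.Computability.Complexity.LengthCompare
import Literature.Computability.Complexity.OracleProofs
import HarnessLib

/-!
# The CIKK learner and its evaluator as oracle machines

Machine-layer instalment (M8e-3) of the decomposition of the named fact
`Literature.Computability.Learning.cikk_natural_implies_learning` (CIKK 2016, Thm. 5.1): the
learner `cikkLearner dR = ttFnAlg lrnQFn qA (lrnGFn dR)` (a truth-table transducer asking the
`qA(|x|)` scheduled membership queries and outputting the first validated candidate) and the
evaluator `cikkEval dR` (query-free, one round, the bit of `evalFn dR`); both polynomial-time for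
`dR ∈ FP`, and the closed forms of the PAC run (`runIdx_cikkLearner`) and of the evaluated
hypothesis (`evalHyp_cikkEval_candStr`).

## References

* M. Carmosino, R. Impagliazzo, V. Kabanets, A. Kolokolova, *Learning algorithms from natural
  proofs*, CCC 2016, §5 and Thm. 5.1 [CarmosinoImpagliazzoKabanetsKolokolova2016].
-/

open Polynomial

namespace Literature.Computability.Learning

open Literature.Computability.Complexity Literature.Computability.Complexity.Brick
  Literature.Computability.Complexity.Plumb Literature.Computability.MetaComplexity
  Literature.Computability.Cryptography _root_.Computability Finset

/-! ### The number of queries is polynomial -/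

section Total

variable {n a b : ℕ} {r : List Bool}

/-- **The round polynomial of the learner**: `qA = 2^15 (X+1)^4`. [folklore] -/
noncomputable def qA : Polynomial ℕ := 2 ^ 15 * (X + 1) ^ 4

/-- Processedness is downward closed. [folklore] -/
theorem lvlProcessed_mono {R ℓ ℓ' : ℕ} (h : LvlProcessed n a b R ℓ) (hle : ℓ' ≤ ℓ) : LvlProcessed n a b R ℓ' :=
  le_trans (Finset.sum_le_sum_of_subset (Finset.range_mono (by omega))) h

/-- On a processed level, the run queries fit into the block: `Reps·(L²k+k) ≤ blockLen`. [folklore] -/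
theorem reps_perRun_le_blockLen (ℓ : ℕ) : prmReps (prmS n a b) ℓ * lvlPerRun n a b ℓ ≤ lvlBlockLen n a b ℓ := by
  rw [lvlBlockLen]
  refine le_trans (Nat.mul_le_mul_left _ ?_) (Nat.le_add_right _ _)
  -- `L²k + k ≤ 20 t ≤ runLen`
  have hK := lvlK_pos n a b ℓ
  have hT : lvlK n a b ℓ * (2 ^ ℓ * 2 ^ ℓ * 2 ^ ℓ) ≤ prmT (prmS n a b) ℓ := by
    rw [lvlK, prmK, prmT, ← pow_add, ← pow_add, ← pow_add]
    exact Nat.pow_le_pow_right (by norm_num) (by omega)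
  have hκ : 20 ≤ prmKappa (prmS n a b) ℓ := by rw [prmKappa]; omega
  have h20 : 20 * prmT (prmS n a b) ℓ ≤ lvlRunLen n a b ℓ := by
    rw [lvlRunLen, runLen, stepLen]
    have : prmT (prmS n a b) ℓ * 20 ≤ prmT (prmS n a b) ℓ * (prmKappa (prmS n a b) ℓ + lvlK n a b ℓ * n) :=
      Nat.mul_le_mul_left _ (by omega)
    rw [mul_comm] at this
    exact this.trans (Nat.le_add_left _ _)
  rw [lvlPerRun]
  have hL : 1 ≤ 2 ^ ℓ := Nat.one_le_two_pow
  have e1 : 2 ^ ℓ * 2 ^ ℓ * lvlK n a b ℓ ≤ lvlK n a b ℓ * (2 ^ ℓ * 2 ^ ℓ * 2 ^ ℓ) := by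
    calc 2 ^ ℓ * 2 ^ ℓ * lvlK n a b ℓ = lvlK n a b ℓ * (2 ^ ℓ * 2 ^ ℓ * 1) := by ring
      _ ≤ lvlK n a b ℓ * (2 ^ ℓ * 2 ^ ℓ * 2 ^ ℓ) := Nat.mul_le_mul_left _ (Nat.mul_le_mul_left _ hL)
  have e2 : lvlK n a b ℓ ≤ lvlK n a b ℓ * (2 ^ ℓ * 2 ^ ℓ * 2 ^ ℓ) := by
    calc lvlK n a b ℓ = lvlK n a b ℓ * 1 := (mul_one _).symm
      _ ≤ lvlK n a b ℓ * (2 ^ ℓ * 2 ^ ℓ * 2 ^ ℓ) := Nat.mul_le_mul_left _ (Nat.one_le_iff_ne_zero.2 (by positivity))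
  linarith

/-- The run queries of the processed levels fit into the coins. [folklore] -/
theorem sum_reps_perRun_le :
    (∑ ℓ ∈ Finset.range (r.length + 1), if LvlProcessed n a b r.length ℓ then prmReps (prmS n a b) ℓ * lvlPerRun n a b ℓ else 0) ≤
      r.length := by
  classical
  rw [← Finset.sum_filter]
  set S := (Finset.range (r.length + 1)).filter fun ℓ => LvlProcessed n a b r.length ℓ with hS
  rcases S.eq_empty_or_nonempty with h0 | hne
  · rw [h0, Finset.sum_empty]; exact Nat.zero_le _
  · set m := S.max' hne with hm
    have hmS : m ∈ S := Finset.max'_mem S hne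
    have hproc : LvlProcessed n a b r.length m := (Finset.mem_filter.1 hmS).2
    calc ∑ ℓ ∈ S, prmReps (prmS n a b) ℓ * lvlPerRun n a b ℓ
        ≤ ∑ ℓ ∈ S, lvlBlockLen n a b ℓ := Finset.sum_le_sum fun ℓ _ => reps_perRun_le_blockLen ℓ
      _ ≤ ∑ ℓ ∈ Finset.range (m + 1), lvlBlockLen n a b ℓ :=
          Finset.sum_le_sum_of_subset fun ℓ hℓ => Finset.mem_range.2 (Nat.lt_succ_of_le (S.le_max' ℓ hℓ))
      _ ≤ r.length := hproc

/-- `m(ℓ) ≤ 28160 (n+a+b+ℓ+3)³`. [folklore] -/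
theorem prmM_le (ℓ : ℕ) : prmM (prmS n a b) ℓ ≤ 28160 * (n + a + b + ℓ + 3) ^ 3 := by
  have hs : prmS n a b ≤ n + a + b + 2 := by rw [prmS]; exact Nat.size_le.2 Nat.lt_two_pow_self
  have h4 : 4 ^ prmS n a b ≤ 4 * (n + a + b + 2) ^ 2 := by
    have := two_pow_prmS_le n a b
    calc 4 ^ prmS n a b = (2 ^ prmS n a b) ^ 2 := by rw [← pow_mul, mul_comm, pow_mul]; norm_num
      _ ≤ (2 * (n + a + b + 2)) ^ 2 := Nat.pow_le_pow_left (by omega) 2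
      _ = 4 * (n + a + b + 2) ^ 2 := by ring
  have hsz : Nat.size ℓ ≤ ℓ + 1 := (Nat.size_le.2 Nat.lt_two_pow_self).trans (Nat.le_succ ℓ)
  calc prmM (prmS n a b) ℓ = 64 * 4 ^ prmS n a b * (8 * prmS n a b + 2 * Nat.size ℓ + 8 * ℓ + 108) := by
        rw [prmM, prmKappa]; ring
    _ ≤ 64 * (4 * (n + a + b + 2) ^ 2) * (110 * (n + a + b + ℓ + 3)) :=
        Nat.mul_le_mul (Nat.mul_le_mul_left _ h4) (by omega)
    _ ≤ 64 * (4 * (n + a + b + ℓ + 3) ^ 2) * (110 * (n + a + b + ℓ + 3)) :=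
        Nat.mul_le_mul_right _ (Nat.mul_le_mul_left _ (Nat.mul_le_mul_left _ (Nat.pow_le_pow_left (by omega) 2)))
    _ = 28160 * (n + a + b + ℓ + 3) ^ 3 := by ring

/-- **The schedule is polynomially long**: `totalNQ ≤ qA(|⟨pacParams n a b, r⟩|)`. [folklore] -/
theorem totalNQ_le : totalNQ n a b r ≤ qA.eval (boolPair (pacParams n a b) r).length := by
  classical
  have hx : n + a + b + r.length + 3 ≤ (boolPair (pacParams n a b) r).length := by
    simp only [pacParams, length_boolPair, unaryEncodeNat_eq_ones, length_ones]; omega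
  set N := (boolPair (pacParams n a b) r).length with hN
  have h1 : totalNQ n a b r ≤ (∑ ℓ ∈ Finset.range (r.length + 1),
      if LvlProcessed n a b r.length ℓ then prmReps (prmS n a b) ℓ * lvlPerRun n a b ℓ else 0) +
      ∑ ℓ ∈ Finset.range (r.length + 1), prmM (prmS n a b) ℓ := by
    rw [totalNQ, lvlQoff, ← Finset.sum_add_distrib]
    refine Finset.sum_le_sum fun ℓ _ => ?_
    rw [lvlNQ]; split_ifs <;> omega
  have h2 : ∑ ℓ ∈ Finset.range (r.length + 1), prmM (prmS n a b) ℓ ≤ (r.length + 1) * (28160 * N ^ 3) := by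
    calc ∑ ℓ ∈ Finset.range (r.length + 1), prmM (prmS n a b) ℓ ≤ ∑ _ℓ ∈ Finset.range (r.length + 1), 28160 * N ^ 3 :=
          Finset.sum_le_sum fun ℓ hℓ => (prmM_le ℓ).trans (Nat.mul_le_mul_left _ (Nat.pow_le_pow_left (by
            rw [Finset.mem_range] at hℓ; omega) 3))
      _ = (r.length + 1) * (28160 * N ^ 3) := by rw [Finset.sum_const, Finset.card_range, smul_eq_mul]
  have h3 := sum_reps_perRun_le (n := n) (a := a) (b := b) (r := r)
  have hr : r.length + 1 ≤ N := by omega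
  rw [qA]
  simp only [eval_mul, eval_pow, eval_add, eval_X, eval_one, eval_ofNat]
  have f1 : N ≤ (N + 1) ^ 4 := by
    calc N ≤ N + 1 := Nat.le_succ N
      _ = (N + 1) ^ 1 := (pow_one _).symm
      _ ≤ (N + 1) ^ 4 := Nat.pow_le_pow_right (Nat.succ_pos N) (by norm_num)
  have f2 : N ^ 4 ≤ (N + 1) ^ 4 := Nat.pow_le_pow_left (Nat.le_succ N) 4
  calc totalNQ n a b r ≤ r.length + (r.length + 1) * (28160 * N ^ 3) := by omega
    _ ≤ N + N * (28160 * N ^ 3) := Nat.add_le_add (by omega) (Nat.mul_le_mul_right _ hr)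
    _ = N + 28160 * N ^ 4 := by ring
    _ ≤ 2 ^ 15 * (N + 1) ^ 4 := by linarith

end Total

/-! ### The machines -/

section Machines

variable (dR : List Bool → List Bool)

/-- **The CIKK learner** as an oracle machine: the truth-table transducer with the query function
`lrnQFn`, `qA(|x|)` rounds and the output function `lrnGFn dR`.
[cite: CarmosinoImpagliazzoKabanetsKolokolova2016, §5 (complete algorithm) and Thm. 5.1] -/
noncomputable def cikkLearner : OracleAlg (List Bool) := ttFnAlg lrnQFn qA (lrnGFn dR)

/-- The language decided by the evaluator: the strings `⟨w, x⟩` on which the hypothesis bit is `1`.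
[folklore] -/
def EvalLang : Language Bool := {s | (evalFn dR s).headD false = true}

/-- **The CIKK evaluator** as a query-free oracle machine: the indicator of `EvalLang`.
[cite: CarmosinoImpagliazzoKabanetsKolokolova2016, §5] -/
noncomputable def cikkEval : OracleAlg Bool := OracleAlg.ofFun (EvalLang dR).boolIndicator

variable {dR}

/-- The indicator of `EvalLang` is the first bit of `evalFn`. [folklore] -/
theorem evalLang_boolIndicator (s : List Bool) : (EvalLang dR).boolIndicator s = (evalFn dR s).headD false := by
  by_cases h : (evalFn dR s).headD false = true
  · rw [(Set.mem_iff_boolIndicator _ _).1 (show s ∈ EvalLang dR from h), h]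
  · rw [Bool.not_eq_true] at h
    have hns : s ∉ EvalLang dR := fun hs => by
      have hs' : (evalFn dR s).headD false = true := hs
      rw [h] at hs'
      exact Bool.false_ne_true hs'
    rw [(Set.notMem_iff_boolIndicator _ _).1 hns, h]

/-- `EvalLang dR ∈ P` for `dR ∈ FP`. [cite: CarmosinoImpagliazzoKabanetsKolokolova2016, Thm. 5.1 (running time)] -/
theorem evalLang_mem_P (hdR : dR ∈ FP) : EvalLang dR ∈ Classes.P := by
  refine mem_P_of_mem_FP (comp_mem_FP HashBricks.headBitFn_mem_FP (evalFn_mem_FP hdR)) (EvalLang dR) fun s => ⟨fun hs => ?_, fun hs => ?_⟩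
  · rw [Function.comp_apply, HashBricks.headBitFn_apply, show (evalFn dR s).headD false = true from hs]
  · rw [Function.comp_apply, HashBricks.headBitFn_apply]
    have : (evalFn dR s).headD false = false := by
      cases h : (evalFn dR s).headD false
      · rfl
      · exact absurd h hs
    rw [this]

/-- **The learner is polynomial-time** (for `dR ∈ FP`). [cite: CarmosinoImpagliazzoKabanetsKolokolova2016, Thm. 5.1] -/
theorem isPolyTime_cikkLearner (hdR : dR ∈ FP) : (cikkLearner dR).IsPolyTime (encodingList Bool) :=
  isPolyTime_ttFnAlg lrnQFn_mem_FP (lrnGFn_mem_FP hdR)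

/-- **The evaluator is polynomial-time** (for `dR ∈ FP`). [cite: CarmosinoImpagliazzoKabanetsKolokolova2016, Thm. 5.1] -/
theorem isPolyTime_cikkEval (hdR : dR ∈ FP) : (cikkEval dR).IsPolyTime encodingBoolBool :=
  OracleAlg.isPolyTime_ofFun_holds (polyTimeDecidable_iff.1 (mem_P_iff_holds.1 (evalLang_mem_P hdR)))

/-- **The evaluated hypothesis of a string `w`**: `evalHyp (cikkEval dR) 1 w x = (evalFn dR ⟨w, x⟩)₀`.
[folklore] -/
theorem evalHyp_cikkEval {m : ℕ} (w : List Bool) (x : Fin m → Bool) :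
    evalHyp (cikkEval dR) 1 w x = (evalFn dR (boolPair w (List.ofFn x))).headD false := by
  rw [evalHyp, cikkEval, OracleAlg.run_ofFun_succ, Option.getD_some, evalLang_boolIndicator]

variable (R : CombinatorialProperty) (hdR : ∀ y, dR y = encodeBool ((truthTableLanguage R).boolIndicator y))
include hdR

/-- **The evaluated hypothesis of a candidate string is the run's hypothesis `hypOf`.**
[cite: CarmosinoImpagliazzoKabanetsKolokolova2016, Thm. 5.1] -/
theorem evalHyp_cikkEval_candStr {n : ℕ} (a b : ℕ) (r : List Bool) (f : (Fin n → Bool) → Bool) (ℓ ρ : ℕ) :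
    evalHyp (cikkEval dR) 1 (candStr n a b r f ℓ ρ) = hypOf R n a b r f ℓ ρ := by
  funext x
  rw [evalHyp_cikkEval, evalFn_candStr R hdR, List.headD_cons]

/-- **The PAC run of the learner**: against `pacOracle true f xs` (membership queries; the examples
`xs` are never consulted), within any budget `T > qA(|x|)`, on `x = ⟨pacParams n a b, r⟩` with
`|r| ≥ 1`, the learner outputs `gfnOut R n a b r f`. [cite: CarmosinoImpagliazzoKabanetsKolokolova2016, §5 and Thm. 5.1] -/
theorem runIdx_cikkLearner {n : ℕ} (a b : ℕ) (r : List Bool) (hR : 1 ≤ r.length) (f : (Fin n → Bool) → Bool)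
    (xs : List (Fin n → Bool)) {T : ℕ} (hT : qA.eval (boolPair (pacParams n a b) r).length < T) :
    (cikkLearner dR).runIdx (pacOracle true f xs) T (boolPair (pacParams n a b) r) = some (gfnOut R n a b r f) := by
  rw [cikkLearner, runIdx_ttFnAlg_mq f xs (boolPair (pacParams n a b) r) (schedQuery n a b r)
    (fun i _ => lrnQFn_apply hR i) hT]
  congr 1
  have hTA : TrueAnswers n a b r f (List.ofFn fun i : Fin (qA.eval (boolPair (pacParams n a b) r).length) => f (schedQuery n a b r i)) := by
    refine ⟨by rw [List.length_ofFn]; exact totalNQ_le, fun idx hidx => ?_⟩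
    rw [List.length_ofFn] at hidx
    rw [List.getD_eq_getElem _ _ (by simpa using hidx), List.getElem_ofFn]
  exact lrnGFn_apply R hdR hR hTA

end Machines

end Literature.Computability.Learning
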